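import Summits.SmoothPoincare4.SmoothPoincare4.Theses.RicciFat
import HarnessLib

/-!
# Line `birth` — BC3 skeleton for the crux `RicciFat.FatBeyondWeylGap` (stmt-SmoothPoincare4-18048)

Route `route-SmoothPoincare4-RicciFat`, rank-4 crux (piece 2/2 of the Weyl-gap threshold split of
`RicciFatSphere`), decl `Summit.SmoothPoincare4.SmoothPoincare4.Theses.RicciFat.FatBeyondWeylGap`:

  every closed smooth `M ≃ₕ S⁴` (Hausdorff, second countable, `C^∞` atlas on `ℝ⁴`, compact, Borel)
  carries a `C^∞` Riemannian metric `h` (with its Levi-Civita connection) with `Ric_h ≥ 3h` and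
  `Vol(M, h) > 8π²/9 = Vol(S⁴)/3`.

## The line: the FILL-IN FORM WITH A VOLUME BUDGET (the budget form of `Cruxes/RicciFatSphere/Lines/birth.lean`)

Write a homotopy 4-sphere as `M = 𝔻⁴ ∪_φ Δ` (a closed 4-ball glued to a compact CONTRACTIBLE `Δ` with
`∂Δ ≅ S³`). The round `S⁴` is `B_{ρ₀} ∪ B_{π−ρ₀}`: the small cap `B_{ρ₀}` (boundary the round
`S³(sin ρ₀)`, `II = +cot ρ₀ · g`, volume `Vol(B_{ρ₀}) = 2π²(2/3 − cos ρ₀ + cos³ρ₀/3)`) and the big cap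
`B_{π−ρ₀}` (same boundary, `II = −cot ρ₀ · g`). An ADMISSIBLE FILL-IN of parameters `(sin ρ₀, −cot ρ₀)`
on `Δ` (`IsAdmissibleFillIn`, AdmissibleFillIn.lean: boundary round of radius `sin ρ₀`,
`II ≥ −cot ρ₀ · g|∂Δ`) glues to the small cap by Perelman's lemma (`II₁ + II₂ ≥ 0`). Line `birth` of the
parent crux asked for NEAR-EXTREMAL fill-ins (`Vol ≥ V(ρ₀) − ε` for EVERY `ε`); this piece only needs
the glued volume to clear `8π²/9`, i.e. a fill-in of volume `> 8π²/9 − Vol(B_{ρ₀})` — a DEFICIT BUDGET of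
`16π²/9` (two thirds of the round volume) is allowed:

* `stub_ballSplitting` — TOPOLOGY (KNOWN; L in Lean), verbatim the stub of the parent's line `birth`:
  every closed smooth `M ≃ₕ S⁴` is a boundary gluing `𝔻⁴ ∪_φ Δ` with `Δ` compact contractible, `φ :
  S³ = ∂𝔻⁴ ≅ ∂Δ` (tree theorem `exists_isBoundaryGluing_closedBall` + van Kampen / Mayer–Vietoris /
  Whitehead). Sources: Milnor1963 §3, Hatcher2002 Prop. 3.29 / Cor. 4.33.
* `stub_budgetFillIn` — THE BET (OPEN): every compact contractible smooth `Δ` with `∂Δ ≅ S³` admits,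
  for SOME `ρ₀ ∈ (0, π/2)` and SOME slack `θ > 0`, a `C^∞` Riemannian metric with its Levi-Civita
  connection, `Ric ≥ 3`, admissible of parameters `(sin ρ₀, −cot ρ₀)`, of volume
  `≥ 8π²/9 − Vol(B_{ρ₀}) + 2θ`. True on `Δ ≅ 𝔻⁴` (the big cap: `V(ρ₀) + Vol(B_{ρ₀}) = 8π²/3 > 8π²/9`).
  Why it might fail: false for the `Δ` of an exotic `Σ = 𝔻⁴ ∪ Δ` that is Ricci-thin below `Vol(S⁴)/3`
  (in particular for a `Δ` carrying no `Ric > 0` metric with such boundary data at all); the budget is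
  large but Hang–Wang Thm 3 still forbids a witness that is the cap metric outside a sub-hemispherical
  domain. Sources: Perelman1997BigVolume §4, HangWang2009 Thms 2–3, HeintzeKarcher1978, Burdick2019.
* `stub_capGluingVolume` — ANALYSIS + `Γ₄ = 0` (KNOWN modulo the flagged smoothing rider; L), the
  volume-bookkeeping form of the parent line's `stub_capGluing`: if `M = 𝔻⁴ ∪_φ Δ` and `Δ` carries an
  admissible `(sin ρ₀, −cot ρ₀)` fill-in `h` with `Ric ≥ 3` and `Vol(Δ, h) ≥ W`, then for every `η > 0`
  the closed manifold `M` carries a `C^∞` metric with `Ric ≥ 3` and `Vol ≥ W + Vol(B_{ρ₀}) − η` — glue the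
  small round cap (Perelman 1997 §4 / Burdick 2019 Lemma 1.2), mollify the `C⁰` seam keeping
  `Ric ≥ 3 − η'` with volume loss `≤ η'` (rider F3 of the route header; synthetic form
  Kapovitch–Ketterer–Sturm 2023), rescale by `λ² = (3 − η')/3` (volume factor `λ⁴ → 1`), identify the
  glued manifold with `M` by Cerf's `Γ₄ = 0` (`cerf_diffeomorph_sphere_three_extends_ball`, gluing
  uniqueness `nonempty_diffeomorph_of_isBoundaryGluing_holds`, PROVED) and transport the metric.
  Sources: Perelman1997BigVolume, Burdick2019, KapovitchKettererSturm2023, Cerf1968.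
* `FatBeyondWeylGap_of_stubSigs : stub₁-sig → stub₂-sig → stub₃-sig → crux` — the REAL composition
  (sorry-free): split `M`, give `Δ` its Borel σ-algebra, take `(ρ₀, θ, h)` from stub 2, glue with
  `W = 8π²/9 − Vol(B_{ρ₀}) + 2θ` and `η = θ`: `Vol(M) ≥ 8π²/9 + θ > 8π²/9`.
* `FatBeyondWeylGap_of : FatBeyondWeylGap` — the crux BY NAME from the three declared stubs.

Logical status: `SPC4 ⇒` each stub (1, 3 theorems in print; 2 on `Δ ≅ 𝔻⁴` is the big cap); stubs `⇒`
crux (this file); the crux is NOT known to imply `SPC4` (only together with `RecognitionBeyondWeylGap`).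
BC3 probes (`bc/probe_F_stubs.lean`): no stub cheaply gives the crux or the summit. Disproof used: none
exists for this crux (new item). Barrier honoured: Hang–Wang 2009 Thm 3 — `Δ` replaces the BIG cap
`B_{π−ρ₀} ⊋` hemisphere (the non-rigid side); the sub-critical range `ρ₀ ∈ (0, π/2)` is kept strictly.
-/

noncomputable section

open scoped Manifold ContDiff Topology ENNReal
open ContinuousMap
open Literature.Geometry.Lorentzian (PseudoRiemannianMetric riemannianMeasure)
open Literature.Geometry.Riemannian (HasRicciLowerBound IsAdmissibleFillIn)
open Literature.Topology.FourManifolds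
open Summit.SmoothPoincare4.SmoothPoincare4.Theses.RicciFat (FatBeyondWeylGap)

-- `Summit.<Summit>.<Problem>`: for the single-conjunct summit the duplicate segment is mandated.
set_option linter.dupNamespace false
set_option linter.unusedVariables false

namespace Summit.SmoothPoincare4.SmoothPoincare4.Cruxes.FatBeyondWeylGap.Birth

/-! ## The three registered stubs (`sorry` lives ONLY here) -/

/-- **Stub 1 (KNOWN — topology): a homotopy 4-sphere is a closed 4-ball glued to a compact
contractible piece** (verbatim the stub of `Cruxes/RicciFatSphere/Lines/birth.lean`). For every closed
smooth `M ≃ₕ S⁴` there are a compact contractible `C^∞` 4-manifold with boundary `Δ`, a boundary datum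
`b` of `Δ` and a diffeomorphism `φ : S³ = ∂𝔻⁴ ≅ ∂Δ` with `M = 𝔻⁴ ∪_φ Δ`
(`IsBoundaryGluing (closedBallBoundaryData 3) b φ (𝓡 4) M`): the tree theorem
`exists_isBoundaryGluing_closedBall` (Milnor's Morse disc) transported from `ULift 𝔻⁴`, plus
`π₁(Δ) = 1` (van Kampen), `H̃_*(Δ) = 0` (Mayer–Vietoris), Whitehead. Size L.
[cite: Milnor1963, §3] [cite: Hatcher2002, Prop. 3.29, Cor. 4.33] -/
theorem stub_ballSplitting :
    ∀ (M : Type) [TopologicalSpace M] [T2Space M] [SecondCountableTopology M]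
      [ChartedSpace (EuclideanSpace ℝ (Fin 4)) M] [IsManifold (𝓡 4) ∞ M] [CompactSpace M],
      M ≃ₕ Metric.sphere (0 : EuclideanSpace ℝ (Fin 5)) 1 →
        ∃ (Δ : Type) (_ : TopologicalSpace Δ) (_ : T2Space Δ) (_ : SecondCountableTopology Δ)
          (_ : ChartedSpace (EuclideanHalfSpace 4) Δ) (_ : IsManifold (𝓡∂ 4) ∞ Δ)
          (b : BoundaryData (𝓡∂ 4) Δ (𝓡 3))
          (φ : (closedBallBoundaryData 3).carrier ≃ₘ⟮𝓡 3, 𝓡 3⟯ b.carrier),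
          CompactSpace Δ ∧ ContractibleSpace Δ ∧
            IsBoundaryGluing (closedBallBoundaryData 3) b φ (𝓡 4) M := by
  sorry

/-- **Stub 2 (OPEN — the bet, "contractible pieces can be filled beyond the Weyl gap"): an admissible
big-cap fill-in with a volume BUDGET exists on every compact contractible `Δ` with `∂Δ ≅ S³`.** For
every compact contractible `C^∞` 4-manifold with boundary `Δ` (Hausdorff, second countable, Borel
σ-algebra) with a boundary datum `b` whose boundary 3-manifold is diffeomorphic to `S³`, there are
`ρ₀ ∈ (0, π/2)`, a slack `θ > 0` and a `C^∞` Riemannian metric `h` on `TΔ` (with its Levi-Civita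
connection) with `Ric_h ≥ 3h` (`HasRicciLowerBound … 3`), ADMISSIBLE of parameters `(sin ρ₀, −cot ρ₀)`
(`IsAdmissibleFillIn`: `(∂Δ, h|∂Δ)` isometric to the round `S³(sin ρ₀)`, `II ≥ −cot ρ₀ · h|∂Δ` for the
outer unit normal) and `Vol(Δ, h) ≥ 8π²/9 − Vol(B_{ρ₀}) + 2θ`, `Vol(B_{ρ₀}) = 2π²(2/3 − cos ρ₀ + cos³ρ₀/3)`.
On `Δ ≅ 𝔻⁴` the big cap works (`V(ρ₀) + Vol(B_{ρ₀}) = 8π²/3`). Why it might fail: false for the `Δ` of a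
homotopy sphere that is Ricci-thin below `Vol(S⁴)/3`; Hang–Wang Thm 3 forbids witnesses equal to the
cap outside a sub-hemispherical domain. Size: open problem (the piece's content, localised on a FIXED
compact piece with controlled boundary and a budget of `16π²/9`).
[cite: Perelman1997BigVolume, §4] [cite: HangWang2009, Thms. 2–3] [cite: HeintzeKarcher1978, §3] -/
theorem stub_budgetFillIn :
    ∀ (Δ : Type) [TopologicalSpace Δ] [T2Space Δ] [SecondCountableTopology Δ]
      [ChartedSpace (EuclideanHalfSpace 4) Δ] [IsManifold (𝓡∂ 4) ∞ Δ] [CompactSpace Δ]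
      [ContractibleSpace Δ] [MeasurableSpace Δ] [BorelSpace Δ]
      (b : BoundaryData (𝓡∂ 4) Δ (𝓡 3)),
      Nonempty (b.carrier ≃ₘ⟮𝓡 3, 𝓡 3⟯ Metric.sphere (0 : EuclideanSpace ℝ (Fin 4)) 1) →
        ∃ ρ₀ θ : ℝ, 0 < ρ₀ ∧ ρ₀ < Real.pi / 2 ∧ 0 < θ ∧
        ∃ h : Bundle.ContMDiffRiemannianMetric (𝓡∂ 4) ∞ (EuclideanSpace ℝ (Fin 4))
            (TangentSpace (𝓡∂ 4) : Δ → Type _),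
          ∃ _ : (PseudoRiemannianMetric.ofRiemannian h).HasLeviCivita,
            HasRicciLowerBound (PseudoRiemannianMetric.ofRiemannian h) 3 ∧
            IsAdmissibleFillIn (PseudoRiemannianMetric.ofRiemannian h) b (Real.sin ρ₀) (-Real.cot ρ₀) ∧
            ENNReal.ofReal (8 * Real.pi ^ 2 / 9 - (2 * Real.pi ^ 2 * (2 / 3 - Real.cos ρ₀ + Real.cos ρ₀ ^ 3 / 3)) + 2 * θ) ≤
              riemannianMeasure h Set.univ := by
  sorry

/-- **Stub 3 (KNOWN modulo one flagged rider — comparison geometry + `Γ₄ = 0`): closing an admissibly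
filled piece by a round cap, with volume bookkeeping.** Let the closed smooth 4-manifold `M` be a
boundary gluing `𝔻⁴ ∪_φ Δ` of the closed unit 4-ball and a compact `C^∞` 4-manifold with boundary `Δ`
(boundary datum `b`, `φ : S³ ≅ ∂Δ`), let `ρ₀ ∈ (0, π/2)`, and let `h` be a `C^∞` Riemannian metric on
`Δ` with its Levi-Civita connection, `Ric ≥ 3`, admissible of parameters `(sin ρ₀, −cot ρ₀)`, of volume
`≥ W`. Then for every `η > 0` there is a `C^∞` Riemannian metric `h'` on `M` (with its Levi-Civita
connection) with `Ric_{h'} ≥ 3h'` and `Vol(M, h') ≥ W + Vol(B_{ρ₀}) − η`. Proof in print: glue the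
small round cap `B_{ρ₀}` (boundary `S³(sin ρ₀)`, `II = cot ρ₀`, so `II_Δ + II_cap ≥ 0`) along the
boundary isometry (Perelman 1997 §4; Burdick 2019 Lemma 1.2), mollify keeping `Ric ≥ 3 − η'` with volume
loss `≤ η'` (rider F3), rescale by `λ² = (3 − η')/3`, identify `𝔻⁴ ∪_{φ'} Δ ≅ M` by Cerf's `Γ₄ = 0`
(`cerf_diffeomorph_sphere_three_extends_ball`, `nonempty_diffeomorph_of_isBoundaryGluing_holds`) and
transport the metric. No hypothesis on the topology of `Δ`. Why it might fail: only via the smoothing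
rider. Size L. [cite: Perelman1997BigVolume, §4] [cite: Burdick2019, Lemma 1.2]
[cite: KapovitchKettererSturm2023] [cite: Cerf1968, Γ₄ = 0] -/
theorem stub_capGluingVolume :
    ∀ (M : Type) [TopologicalSpace M] [T2Space M] [SecondCountableTopology M]
      [ChartedSpace (EuclideanSpace ℝ (Fin 4)) M] [IsManifold (𝓡 4) ∞ M] [CompactSpace M]
      [MeasurableSpace M] [BorelSpace M]
      (Δ : Type) [TopologicalSpace Δ] [T2Space Δ] [SecondCountableTopology Δ]
      [ChartedSpace (EuclideanHalfSpace 4) Δ] [IsManifold (𝓡∂ 4) ∞ Δ] [CompactSpace Δ]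
      [MeasurableSpace Δ] [BorelSpace Δ]
      (b : BoundaryData (𝓡∂ 4) Δ (𝓡 3))
      (φ : (closedBallBoundaryData 3).carrier ≃ₘ⟮𝓡 3, 𝓡 3⟯ b.carrier),
      IsBoundaryGluing (closedBallBoundaryData 3) b φ (𝓡 4) M →
      ∀ ρ₀ : ℝ, 0 < ρ₀ → ρ₀ < Real.pi / 2 →
      ∀ (h : Bundle.ContMDiffRiemannianMetric (𝓡∂ 4) ∞ (EuclideanSpace ℝ (Fin 4))
          (TangentSpace (𝓡∂ 4) : Δ → Type _))
        [(PseudoRiemannianMetric.ofRiemannian h).HasLeviCivita],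
        HasRicciLowerBound (PseudoRiemannianMetric.ofRiemannian h) 3 →
        IsAdmissibleFillIn (PseudoRiemannianMetric.ofRiemannian h) b (Real.sin ρ₀) (-Real.cot ρ₀) →
      ∀ W : ℝ, ENNReal.ofReal W ≤ riemannianMeasure h Set.univ →
      ∀ η : ℝ, 0 < η →
        ∃ h' : Bundle.ContMDiffRiemannianMetric (𝓡 4) ∞ (EuclideanSpace ℝ (Fin 4))
            (TangentSpace (𝓡 4) : M → Type _),
          ∃ _ : (PseudoRiemannianMetric.ofRiemannian h').HasLeviCivita,
            (∀ (x : M) (v : TangentSpace (𝓡 4) x),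
              3 * h'.inner x v v ≤ (PseudoRiemannianMetric.ofRiemannian h').ricci x v v) ∧
            ENNReal.ofReal (W + (2 * Real.pi ^ 2 * (2 / 3 - Real.cos ρ₀ + Real.cos ρ₀ ^ 3 / 3)) - η) ≤ riemannianMeasure h' Set.univ := by
  sorry

/-! ## The composition: the three stubs prove the crux BY NAME (no `sorry` below this line) -/

/-- **Composition with explicit hypotheses** (`stub₁-sig → stub₂-sig → stub₃-sig → crux`): split the
homotopy sphere as `M = 𝔻⁴ ∪_φ Δ` (stub 1), equip `Δ` with its Borel σ-algebra, note `∂Δ ≅ S³`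
through `φ⁻¹`, take the budget fill-in `(ρ₀, θ, h)` of stub 2 and glue the cap with
`W = 8π²/9 − Vol(B_{ρ₀}) + 2θ`, `η = θ` (stub 3): `Vol(M) ≥ 8π²/9 + θ > 8π²/9`.
[cite: Perelman1997BigVolume, §4] -/
theorem FatBeyondWeylGap_of_stubSigs
    (h₁ : ∀ (M : Type) [TopologicalSpace M] [T2Space M] [SecondCountableTopology M]
      [ChartedSpace (EuclideanSpace ℝ (Fin 4)) M] [IsManifold (𝓡 4) ∞ M] [CompactSpace M],
      M ≃ₕ Metric.sphere (0 : EuclideanSpace ℝ (Fin 5)) 1 →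
        ∃ (Δ : Type) (_ : TopologicalSpace Δ) (_ : T2Space Δ) (_ : SecondCountableTopology Δ)
          (_ : ChartedSpace (EuclideanHalfSpace 4) Δ) (_ : IsManifold (𝓡∂ 4) ∞ Δ)
          (b : BoundaryData (𝓡∂ 4) Δ (𝓡 3))
          (φ : (closedBallBoundaryData 3).carrier ≃ₘ⟮𝓡 3, 𝓡 3⟯ b.carrier),
          CompactSpace Δ ∧ ContractibleSpace Δ ∧
            IsBoundaryGluing (closedBallBoundaryData 3) b φ (𝓡 4) M)
    (h₂ : ∀ (Δ : Type) [TopologicalSpace Δ] [T2Space Δ] [SecondCountableTopology Δ]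
      [ChartedSpace (EuclideanHalfSpace 4) Δ] [IsManifold (𝓡∂ 4) ∞ Δ] [CompactSpace Δ]
      [ContractibleSpace Δ] [MeasurableSpace Δ] [BorelSpace Δ]
      (b : BoundaryData (𝓡∂ 4) Δ (𝓡 3)),
      Nonempty (b.carrier ≃ₘ⟮𝓡 3, 𝓡 3⟯ Metric.sphere (0 : EuclideanSpace ℝ (Fin 4)) 1) →
        ∃ ρ₀ θ : ℝ, 0 < ρ₀ ∧ ρ₀ < Real.pi / 2 ∧ 0 < θ ∧
        ∃ h : Bundle.ContMDiffRiemannianMetric (𝓡∂ 4) ∞ (EuclideanSpace ℝ (Fin 4))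
            (TangentSpace (𝓡∂ 4) : Δ → Type _),
          ∃ _ : (PseudoRiemannianMetric.ofRiemannian h).HasLeviCivita,
            HasRicciLowerBound (PseudoRiemannianMetric.ofRiemannian h) 3 ∧
            IsAdmissibleFillIn (PseudoRiemannianMetric.ofRiemannian h) b (Real.sin ρ₀) (-Real.cot ρ₀) ∧
            ENNReal.ofReal (8 * Real.pi ^ 2 / 9 - (2 * Real.pi ^ 2 * (2 / 3 - Real.cos ρ₀ + Real.cos ρ₀ ^ 3 / 3)) + 2 * θ) ≤
              riemannianMeasure h Set.univ)
    (h₃ : ∀ (M : Type) [TopologicalSpace M] [T2Space M] [SecondCountableTopology M]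
      [ChartedSpace (EuclideanSpace ℝ (Fin 4)) M] [IsManifold (𝓡 4) ∞ M] [CompactSpace M]
      [MeasurableSpace M] [BorelSpace M]
      (Δ : Type) [TopologicalSpace Δ] [T2Space Δ] [SecondCountableTopology Δ]
      [ChartedSpace (EuclideanHalfSpace 4) Δ] [IsManifold (𝓡∂ 4) ∞ Δ] [CompactSpace Δ]
      [MeasurableSpace Δ] [BorelSpace Δ]
      (b : BoundaryData (𝓡∂ 4) Δ (𝓡 3))
      (φ : (closedBallBoundaryData 3).carrier ≃ₘ⟮𝓡 3, 𝓡 3⟯ b.carrier),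
      IsBoundaryGluing (closedBallBoundaryData 3) b φ (𝓡 4) M →
      ∀ ρ₀ : ℝ, 0 < ρ₀ → ρ₀ < Real.pi / 2 →
      ∀ (h : Bundle.ContMDiffRiemannianMetric (𝓡∂ 4) ∞ (EuclideanSpace ℝ (Fin 4))
          (TangentSpace (𝓡∂ 4) : Δ → Type _))
        [(PseudoRiemannianMetric.ofRiemannian h).HasLeviCivita],
        HasRicciLowerBound (PseudoRiemannianMetric.ofRiemannian h) 3 →
        IsAdmissibleFillIn (PseudoRiemannianMetric.ofRiemannian h) b (Real.sin ρ₀) (-Real.cot ρ₀) →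
      ∀ W : ℝ, ENNReal.ofReal W ≤ riemannianMeasure h Set.univ →
      ∀ η : ℝ, 0 < η →
        ∃ h' : Bundle.ContMDiffRiemannianMetric (𝓡 4) ∞ (EuclideanSpace ℝ (Fin 4))
            (TangentSpace (𝓡 4) : M → Type _),
          ∃ _ : (PseudoRiemannianMetric.ofRiemannian h').HasLeviCivita,
            (∀ (x : M) (v : TangentSpace (𝓡 4) x),
              3 * h'.inner x v v ≤ (PseudoRiemannianMetric.ofRiemannian h').ricci x v v) ∧
            ENNReal.ofReal (W + (2 * Real.pi ^ 2 * (2 / 3 - Real.cos ρ₀ + Real.cos ρ₀ ^ 3 / 3)) - η) ≤ riemannianMeasure h' Set.univ) :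
    FatBeyondWeylGap := by
  intro M _ _ _ _ _ _ _ _ e
  -- stub 1: `M = 𝔻⁴ ∪_φ Δ` with `Δ` compact contractible
  obtain ⟨Δ, _, _, _, _, _, b, φ, hΔc, hΔk, hglue⟩ := h₁ M e
  haveI : CompactSpace Δ := hΔc
  haveI : ContractibleSpace Δ := hΔk
  -- the Borel σ-algebra of `Δ` feeds `riemannianMeasure`
  letI : MeasurableSpace Δ := borel Δ
  haveI : BorelSpace Δ := ⟨rfl⟩
  -- `∂Δ ≅ ∂𝔻⁴ = S³` through the gluing diffeomorphism
  have hS : Nonempty (b.carrier ≃ₘ⟮𝓡 3, 𝓡 3⟯ Metric.sphere (0 : EuclideanSpace ℝ (Fin 4)) 1) :=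
    ⟨φ.symm⟩
  -- stub 2: a budget fill-in of `Δ`
  obtain ⟨ρ₀, θ, hρ₀, hρ₁, hθ, h, hLC, hRic, hAdm, hVol⟩ := h₂ Δ b hS
  haveI := hLC
  -- stub 3: glue the cap with `W = 8π²/9 − Vol(B_{ρ₀}) + 2θ` and `η = θ`
  obtain ⟨h', hLC', hRic', hVol'⟩ := h₃ M Δ b φ hglue ρ₀ hρ₀ hρ₁ h hRic hAdm
    (8 * Real.pi ^ 2 / 9 - (2 * Real.pi ^ 2 * (2 / 3 - Real.cos ρ₀ + Real.cos ρ₀ ^ 3 / 3)) + 2 * θ) hVol θ hθ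
  refine ⟨h', hLC', hRic', lt_of_lt_of_le ?_ hVol'⟩
  -- `8π²/9 < 8π²/9 + θ = W + Vol(B_{ρ₀}) − θ`
  have hW : 8 * Real.pi ^ 2 / 9 - (2 * Real.pi ^ 2 * (2 / 3 - Real.cos ρ₀ + Real.cos ρ₀ ^ 3 / 3)) + 2 * θ + (2 * Real.pi ^ 2 * (2 / 3 - Real.cos ρ₀ + Real.cos ρ₀ ^ 3 / 3)) - θ =
      8 * Real.pi ^ 2 / 9 + θ := by ring
  rw [hW]
  exact (ENNReal.ofReal_lt_ofReal_iff (by positivity)).2 (by linarith)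

/-- **THE SKELETON THEOREM.** The crux
`Summit.SmoothPoincare4.SmoothPoincare4.Theses.RicciFat.FatBeyondWeylGap`, concluded BY NAME from the
three DECLARED stubs `stub_ballSplitting`, `stub_budgetFillIn`, `stub_capGluingVolume` (the only
`sorry`s of the file) through the sorry-free composition `FatBeyondWeylGap_of_stubSigs`.
[cite: Perelman1997BigVolume, §4] -/
theorem FatBeyondWeylGap_of : FatBeyondWeylGap :=
  FatBeyondWeylGap_of_stubSigs stub_ballSplitting stub_budgetFillIn stub_capGluingVolume

end Summit.SmoothPoincare4.SmoothPoincare4.Cruxes.FatBeyondWeylGap.Birth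

end
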